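import Summits.QuantumFields.YangMills.Theorems.UnitScaleTiltProp7Growth142T3ChartELCurrent
import Summits.QuantumFields.YangMills.Theorems.UnitScaleTiltProp7Taylor3ActionUniform
import HarnessLib

/-!
# Route `UnitScaleTilt`, crux K1 child «MinimiserStabilityRegPr» (stmt-QuantumFields-19200) — ROW E′ (OWNER RULING g24-№3) IN THE (α)-CURRENCY, k-UNIFORM SHAPE:
# E′ ⇐ CHART_W^Σ ∧ NORMAL_W ∧ HESS_W′ with the chart radius `s₀·L^{−(K−n)}`, the Σ_k-curvature `c₀·L^{K−n}` and the slice gap `κ₀·L^{−2(K−n)}` DISPLAYED IN THEIR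
# NATURAL SCALINGS and an `L`-only smallness condition; (141) and the Taylor row are theorems

Cell `ym3-torus`, width seat `ym-ust-19200-w4` (gen 4; supersedes the uniform half of the seat's `PV3ESigma.stub_PV3E_of_chartRowsSigma` after its LOCATED correction
2026-08-28: there `s, c_N, κ` were quantified per `L` before the member although they scale like `ℓ⁻¹, ℓ, ℓ⁻²` (`ℓ = L^{K−n}`), and the Taylor ∕ first-variation rows
were charged at rates one power of `ℓ` too weak).  THEOREMS ONLY (0 `def`, 0 `sorry`).  YM₃ on T³ is a ladder rung (R3), not the Clay problem; nothing here claims the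
stub, the crux, d = 4 or the mass gap; E′ is NOT closed by this file — it is reduced to three displayed rows of [Balaban1985Variational] Sect. E at the critical background.

THE ARITHMETIC (θ = ½ in `Prop7Taylor3Uniform.wilsonAction4_expChart_sub_lin_ge`; `a = regThreshold e = e·ℓ⁻²`; current rate `e·ℓ⁻³`
(`Prop7Growth142T3ChartELCurrent.abs_lin_chart_le_of_sigmaVelocity_current`)): for a competitor with chart coordinate `D`,
`A(W′) − A(W) ≥ ℓ_W(D) + ¼Σ_p‖ℒ_p(D)‖² − (15552s² + 216eℓ⁻²)Σ‖D‖² ≥ [¼κ − 15552s² − 216eℓ⁻² − eℓ⁻³c_N]·Σ_b‖D(b)‖²`; with `s = s₀ℓ⁻¹`, `c_N = c₀ℓ`, `κ = κ₀ℓ⁻²` the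
bracket is `ℓ⁻²·[¼κ₀ − 15552s₀² − 216e − e·c₀] ≥ 0` as soon as `15552s₀² + 216e₆ + e₆c₀ ≤ ¼κ₀` — a condition on `L`-only constants.

WHAT IS PROVED (ns `…Theorems.PV3ESigmaUniform`).  §1 ★★ `isMinOn_regFibrePr_of_sliceRows_at` (one member, one datum; rows CHART_W^Σ (`‖D(b)‖ ≤ s`, `A(W′) = A(e^{iD}W)`,
a Σ_k-curve through `W` with bond velocities `ξ`), NORMAL_W (`Σ_b‖iD(b) − ξ(b)‖ ≤ c_N·Σ‖D‖²`), HESS_W′ (`κ·Σ_b‖D(b)‖² ≤ Σ_p‖ℒ_p(D)‖²`, the linearised-curvature Poincaré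
inequality on print's slice); smallness `15552s² + 216·regThreshold(e) + e·(L^{K−n})⁻³·c_N ≤ κ∕4`).  §2 `scaled_smallness` (the `ℓ`-bookkeeping) and
★★★ `stub_PV3E_of_sliceRows`: the E′ TEXT OF RECORD (verbatim; `e₅ := e₆`, `a₁'' := 1`) from ONE displayed uniform hypothesis with `L`-only constants
`e₆ > 0`, `0 ≤ s₀ ≤ ¼`, `c₀ ≥ 0`, `κ₀` and `15552s₀² + 216e₆ + e₆c₀ ≤ κ₀∕4`, the rows at every member read at `s₀·L^{−(K−n)}`, `c₀·L^{K−n}`, `κ₀·L^{−2(K−n)}`.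

HONEST SCOPE.  Bookkeeping over landed letters.  DISPLAYED, not proved: CHART_W^Σ with a Σ_k-curve ([Balaban1985RegularSpaces] Thm 2 at the critical background, whose
(1.33)-regularity is Sect. F ∕ the H side), NORMAL_W ([Balaban1985Variational] (47)–(48), the `ℓ¹` size of `H·`(quadratic defect)), HESS_W′ ((116) ∕
[Balaban1985BackgroundPropagators] Thm 3.11–3.12 = the N06 node; numerically coercive on print's slice, ★p1 g12 2026-08-28).  Whether these three are JOINTLY
inhabitable with `L`-only constants is exactly the content of print's Sect. E at the critical background; nothing of it is asserted here.
`--supports stmt-QuantumFields-19200`, count-neutral.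

References: T. Bałaban, CMP 102 (1985) 277–309 [Balaban1985Variational] ((2), (4)–(7) p.278, (14) p.280, (19) p.281, (47)–(48) pp.285–286, (116) p.295, (141)–(142), Prop. 7 p.299);
CMP 99 (1985) 75–102 [Balaban1985RegularSpaces] ((1.9) p.77, Thm 2 p.83).
-/

set_option autoImplicit false
noncomputable section

open scoped BigOperators Matrix.Norms.L2Operator Matrix Topology
open Filter

namespace Summit.QuantumFields.YangMills.Theorems.PV3ESigmaUniform

open Literature.MathematicalPhysics.QuantumFieldTheory.Balaban1983to89
open Literature.MathematicalPhysics.QuantumFieldTheory.Balaban1983to89.T3ContinuumYM3Torus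
open Literature.MathematicalPhysics.QuantumFieldTheory.Balaban1983to89.T3UnitLawDensityEML (ℰp)
open Literature.MathematicalPhysics.QuantumFieldTheory.Balaban1983to89.T3ConstrainedMinimiser
open Literature.MathematicalPhysics.QuantumFieldTheory.Balaban1983to89.T3Thm1Carrier
open Literature.MathematicalPhysics.QuantumFieldTheory.Balaban1983to89.T3PrintedRegularMinimiser
open Literature.MathematicalPhysics.QuantumFieldTheory.Balaban1983to89.T3RegularMinimiser
open Literature.MathematicalPhysics.QuantumFieldTheory.Balaban1983to89.T3Thm1CarrierNative (IsCritR2)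
open Literature.MathematicalPhysics.QuantumFieldTheory.Balaban1983to89.T3SectALandauChart (emb15 CloseAvg pos_of_regPr)
open Summit.QuantumFields.YangMills.Theorems.Prop7TPrint (expHermField)
open Summit.QuantumFields.YangMills.Theorems.Prop7Taylor3Uniform (wilsonAction4_expChart_sub_lin_ge)
open Summit.QuantumFields.YangMills.Theorems.Prop7Growth142T3ChartELCurrent (abs_lin_chart_le_of_sigmaVelocity_current)

/-! ## §1 One member, one datum -/

/-- ★★ **E′ AT A DATUM FROM CHART_W^Σ ∧ NORMAL_W ∧ HESS_W′, (141) AND TAYLOR DISCHARGED AT THE RIGHT RATES.**  `W ∈ (6)(e) ∩ 𝔅_k(V)` R2-critical; every competitor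
`W′ ∈ (6)(e) ∩ 𝔅_k(V)` comes with a Hermitian-traceless `D`, `‖D(b)‖ ≤ s`, `A(W′) = A(e^{iD}W)`, a Σ_k-curve through `W` with bond velocities `ξ`,
`Σ_b‖iD(b) − ξ(b)‖ ≤ c_N·Σ‖D‖²` and `κ·Σ‖D‖² ≤ Σ_p‖ℒ_p(D)‖²`.  If `4s ≤ 1` and `15552s² + 216·regThreshold(e) + e·(L^{K−n})⁻³·c_N ≤ κ∕4`, then `W`
minimises the Wilson action over (6)(e). [cite: Balaban1985Variational, (141)-(142) p.299, (47)-(48) pp.285-286, (116) p.295, (6) p.278] -/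
theorem isMinOn_regFibrePr_of_sliceRows_at (F : T3Family) {n K : ℕ} (h : n ≤ K) {e s cN κ : ℝ}
    (V : GaugeField (F.P n) 0 (Matrix.specialUnitaryGroup (Fin 2) ℂ)) {W : GaugeField (F.P K) 0 (Matrix.specialUnitaryGroup (Fin 2) ℂ)}
    (hW : IsCritR2 F n K h V W) (hWe : W ∈ regFibrePr F n K h e V)
    (hrows : ∀ W' : GaugeField (F.P K) 0 (Matrix.specialUnitaryGroup (Fin 2) ℂ), W' ∈ regFibrePr F n K h e V →
        ∃ (D : PBond (F.P K) 0 → Matrix (Fin 2) (Fin 2) ℂ) (γ : ℝ → GaugeField (F.P K) 0 (Matrix.specialUnitaryGroup (Fin 2) ℂ)) (ξ : PBond (F.P K) 0 → Matrix (Fin 2) (Fin 2) ℂ),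
          (∀ b : PBond (F.P K) 0, (D b).IsHermitian ∧ Matrix.trace (D b) = 0) ∧ (∀ b : PBond (F.P K) 0, ‖D b‖ ≤ s) ∧
          wilsonAction4 W' = wilsonAction4 (emb15 W (expHermField D)) ∧
          γ 0 = W ∧ ContinuousAt γ 0 ∧
          (∀ᶠ t in 𝓝 (0 : ℝ), ∃ u : GaugeTransf (F.P K) 0 (Matrix.specialUnitaryGroup (Fin 2) ℂ), GaugeField.gaugeAct u (γ t) ∈ fibre F ℰp n K h V) ∧
          (∀ b : PBond (F.P K) 0, HasDerivAt (fun t : ℝ => (γ t b : Matrix (Fin 2) (Fin 2) ℂ) * star (W b : Matrix (Fin 2) (Fin 2) ℂ)) (ξ b) 0) ∧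
          (∑ b : PBond (F.P K) 0, ‖Complex.I • D b - ξ b‖ ≤ cN * ∑ b : PBond (F.P K) 0, ‖D b‖ ^ 2) ∧
          κ * ∑ b : PBond (F.P K) 0, ‖D b‖ ^ 2
            ≤ ∑ p : Plaq (F.P K) 0, ‖((Complex.I • D ⟨p.src, p.μ⟩) + ((W ⟨p.src, p.μ⟩ : Matrix (Fin 2) (Fin 2) ℂ) * (Complex.I • D ⟨p.src.shift p.μ, p.ν⟩) * star (W ⟨p.src, p.μ⟩ : Matrix (Fin 2) (Fin 2) ℂ))
            - (((W ⟨p.src, p.μ⟩ * W ⟨p.src.shift p.μ, p.ν⟩ * (W ⟨p.src.shift p.ν, p.μ⟩)⁻¹ : Matrix.specialUnitaryGroup (Fin 2) ℂ) : Matrix (Fin 2) (Fin 2) ℂ) * (Complex.I • D ⟨p.src.shift p.ν, p.μ⟩) * star ((W ⟨p.src, p.μ⟩ * W ⟨p.src.shift p.μ, p.ν⟩ * (W ⟨p.src.shift p.ν, p.μ⟩)⁻¹ : Matrix.specialUnitaryGroup (Fin 2) ℂ) : Matrix (Fin 2) (Fin 2) ℂ))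
            - (((GaugeField.plaqHol W p : Matrix.specialUnitaryGroup (Fin 2) ℂ) : Matrix (Fin 2) (Fin 2) ℂ) * (Complex.I • D ⟨p.src, p.ν⟩) * star ((GaugeField.plaqHol W p : Matrix.specialUnitaryGroup (Fin 2) ℂ) : Matrix (Fin 2) (Fin 2) ℂ)))‖ ^ 2)
    (hs4 : 4 * s ≤ 1)
    (hsmall : 15552 * s ^ 2 + 216 * regThreshold F n K e + e * (((F.L : ℝ) ^ (K - n)) ^ 3)⁻¹ * cN ≤ κ / 4) :
    IsMinOn (fun W' : GaugeField (F.P K) 0 (Matrix.specialUnitaryGroup (Fin 2) ℂ) => wilsonAction4 W') (regFibrePr F n K h e V) W := by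
  intro W' hW'
  obtain ⟨D, γ, ξ, hDh, hDs, hA, hγ0, hγc, hγfib, hγξ, hN, hq⟩ := hrows W' hW'
  show wilsonAction4 W ≤ wilsonAction4 W'
  rw [hA]
  have hreg : RegPr F n K e W := ((mem_regFibrePr_iff F).mp hWe).2
  have he0 : 0 < e := pos_of_regPr F hreg
  have hthr0 : 0 ≤ regThreshold F n K e := by unfold regThreshold; positivity
  have ha : ∀ p : Plaq (F.P K) 0, ‖((GaugeField.plaqHol W p : Matrix.specialUnitaryGroup (Fin 2) ℂ) : Matrix (Fin 2) (Fin 2) ℂ) - 1‖ ≤ regThreshold F n K e := fun p => by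
    have hp := hreg.1 p
    rw [SU2Mean.dist1_eq_norm] at hp
    exact hp.le
  -- TAYLOR at θ = ½ and EL at the current rate
  have hT := wilsonAction4_expChart_sub_lin_ge W D hDh hDs hs4 hthr0 ha (θ := 1 / 2) (by norm_num) (by norm_num)
  rw [show ((1 : ℝ) - 1 / 2) / 2 = 1 / 4 by norm_num, show (7776 : ℝ) * (1 / 2)⁻¹ = 15552 by norm_num] at hT
  have hEL := abs_lin_chart_le_of_sigmaVelocity_current hW hWe D γ hγ0 hγc hγfib ξ hγξ
  have hL1 : (1 : ℝ) ≤ (F.L : ℝ) := by have := F.hL.2; exact_mod_cast (by omega : 1 ≤ F.L)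
  have hj0 : 0 ≤ e * (((F.L : ℝ) ^ (K - n)) ^ 3)⁻¹ := by positivity
  have hS0 : 0 ≤ ∑ b : PBond (F.P K) 0, ‖D b‖ ^ 2 := Finset.sum_nonneg fun _ _ => sq_nonneg _
  have hEL' : |∑ p : Plaq (F.P K) 0, (1 / 2) * (((((GaugeField.plaqHol W p : Matrix.specialUnitaryGroup (Fin 2) ℂ) : Matrix (Fin 2) (Fin 2) ℂ) - 1)ᴴ * (((Complex.I • D ⟨p.src, p.μ⟩) + ((W ⟨p.src, p.μ⟩ : Matrix (Fin 2) (Fin 2) ℂ) * (Complex.I • D ⟨p.src.shift p.μ, p.ν⟩) * star (W ⟨p.src, p.μ⟩ : Matrix (Fin 2) (Fin 2) ℂ))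
            - (((W ⟨p.src, p.μ⟩ * W ⟨p.src.shift p.μ, p.ν⟩ * (W ⟨p.src.shift p.ν, p.μ⟩)⁻¹ : Matrix.specialUnitaryGroup (Fin 2) ℂ) : Matrix (Fin 2) (Fin 2) ℂ) * (Complex.I • D ⟨p.src.shift p.ν, p.μ⟩) * star ((W ⟨p.src, p.μ⟩ * W ⟨p.src.shift p.μ, p.ν⟩ * (W ⟨p.src.shift p.ν, p.μ⟩)⁻¹ : Matrix.specialUnitaryGroup (Fin 2) ℂ) : Matrix (Fin 2) (Fin 2) ℂ))
            - (((GaugeField.plaqHol W p : Matrix.specialUnitaryGroup (Fin 2) ℂ) : Matrix (Fin 2) (Fin 2) ℂ) * (Complex.I • D ⟨p.src, p.ν⟩) * star ((GaugeField.plaqHol W p : Matrix.specialUnitaryGroup (Fin 2) ℂ) : Matrix (Fin 2) (Fin 2) ℂ))) * ((GaugeField.plaqHol W p : Matrix.specialUnitaryGroup (Fin 2) ℂ) : Matrix (Fin 2) (Fin 2) ℂ))).trace).re|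
      ≤ e * (((F.L : ℝ) ^ (K - n)) ^ 3)⁻¹ * (cN * ∑ b : PBond (F.P K) 0, ‖D b‖ ^ 2) := by
    exact hEL.trans (mul_le_mul_of_nonneg_left hN hj0)
  have habs := (abs_le.mp hEL').1
  have h3 : 0 ≤ (κ / 4 - 15552 * s ^ 2 - 216 * regThreshold F n K e - e * (((F.L : ℝ) ^ (K - n)) ^ 3)⁻¹ * cN)
      * ∑ b : PBond (F.P K) 0, ‖D b‖ ^ 2 := mul_nonneg (by linarith) hS0
  nlinarith [hT, habs, hq, h3]

/-! ## §2 The E′ text of record with `L`-only constants -/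

/-- The `ℓ`-bookkeeping: with `ℓ = L^{K−n} ≥ 1`, `s = s₀ℓ⁻¹`, `c_N = c₀ℓ`, `κ = κ₀ℓ⁻²`, `regThreshold(e) = eℓ⁻²`, the datum smallness is `ℓ⁻²·(15552s₀² + 216e + e·c₀) ≤ ℓ⁻²·κ₀∕4`. [folklore] -/
theorem scaled_smallness (F : T3Family) (n K : ℕ) {e e₆ s₀ c₀ κ₀ : ℝ} (he : e ≤ e₆) (hc₀ : 0 ≤ c₀)
    (hsmall : 15552 * s₀ ^ 2 + 216 * e₆ + e₆ * c₀ ≤ κ₀ / 4) :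
    15552 * (s₀ * ((F.L : ℝ) ^ (K - n))⁻¹) ^ 2 + 216 * regThreshold F n K e
        + e * (((F.L : ℝ) ^ (K - n)) ^ 3)⁻¹ * (c₀ * (F.L : ℝ) ^ (K - n))
      ≤ κ₀ * (((F.L : ℝ) ^ (K - n)) ^ 2)⁻¹ / 4 := by
  have hL1 : (1 : ℝ) ≤ (F.L : ℝ) := by have := F.hL.2; exact_mod_cast (by omega : 1 ≤ F.L)
  set ℓ : ℝ := (F.L : ℝ) ^ (K - n) with hℓ
  have hℓ1 : 1 ≤ ℓ := one_le_pow₀ hL1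
  have hℓ0 : 0 < ℓ := by linarith
  have hthr : regThreshold F n K e = e * (ℓ ^ 2)⁻¹ := by
    unfold regThreshold
    rw [inv_pow, pow_mul', hℓ]
  rw [hthr]
  have hkey : 15552 * (s₀ * ℓ⁻¹) ^ 2 + 216 * (e * (ℓ ^ 2)⁻¹) + e * (ℓ ^ 3)⁻¹ * (c₀ * ℓ)
      = (ℓ ^ 2)⁻¹ * (15552 * s₀ ^ 2 + 216 * e + e * c₀) := by
    field_simp
  rw [hkey]
  have hmono : 15552 * s₀ ^ 2 + 216 * e + e * c₀ ≤ κ₀ / 4 := by nlinarith [mul_le_mul_of_nonneg_right he hc₀]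
  have hi0 : 0 ≤ (ℓ ^ 2)⁻¹ := by positivity
  have := mul_le_mul_of_nonneg_left hmono hi0
  calc (ℓ ^ 2)⁻¹ * (15552 * s₀ ^ 2 + 216 * e + e * c₀) ≤ (ℓ ^ 2)⁻¹ * (κ₀ / 4) := this
    _ = κ₀ * (ℓ ^ 2)⁻¹ / 4 := by ring

/-- ★★★ **ROW E′ OF SKELETON v9 (OWNER RULING g24-№3; [Balaban1985Variational] (141)–(142) in print's regime) FROM THE (α)-CURRENCY ROWS IN THEIR NATURAL SCALINGS.**
For every `L > 1` constants `e₆ > 0`, `0 ≤ s₀` with `4s₀ ≤ 1`, `c₀ ≥ 0`, `κ₀` with `15552s₀² + 216e₆ + e₆c₀ ≤ κ₀∕4`, such that at every member `(F, n, K)`, every radius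
`0 < e ≤ e₆`, every datum `V` and every R2-critical `W ∈ (6)(e) ∩ 𝔅_k(V)` the rows CHART_W^Σ (radius `s₀·L^{−(K−n)}`), NORMAL_W (`c₀·L^{K−n}`), HESS_W′ (`κ₀·L^{−2(K−n)}`) hold
for every competitor.  CONCLUSION = the E′ text verbatim (`e₅ := e₆`, `a₁'' := 1`); (141) and the Taylor row are theorems; no pinned representative, no un-pinned drift.
[cite: Balaban1985Variational, (141)-(142) p.299, Prop. 7 p.299, (4)-(7) p.278, (14) p.280, (19) p.281, (47)-(48) pp.285-286, (116) p.295] -/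
theorem stub_PV3E_of_sliceRows
    (hrowsU : ∀ (L : ℕ), 1 < L → ∃ e₆ s₀ c₀ κ₀ : ℝ, 0 < e₆ ∧ 0 ≤ s₀ ∧ 4 * s₀ ≤ 1 ∧ 0 ≤ c₀ ∧ 15552 * s₀ ^ 2 + 216 * e₆ + e₆ * c₀ ≤ κ₀ / 4 ∧
      ∀ (F : T3Family), F.L = L → ∀ (n K : ℕ) (hnK : n < K) (e : ℝ) (V : GaugeField (F.P n) 0 (Matrix.specialUnitaryGroup (Fin 2) ℂ))
        (W : GaugeField (F.P K) 0 (Matrix.specialUnitaryGroup (Fin 2) ℂ)),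
        0 < e → e ≤ e₆ → W ∈ regFibrePr F n K hnK.le e V → IsCritR2 F n K hnK.le V W →
        ∀ W' : GaugeField (F.P K) 0 (Matrix.specialUnitaryGroup (Fin 2) ℂ), W' ∈ regFibrePr F n K hnK.le e V →
          ∃ (D : PBond (F.P K) 0 → Matrix (Fin 2) (Fin 2) ℂ) (γ : ℝ → GaugeField (F.P K) 0 (Matrix.specialUnitaryGroup (Fin 2) ℂ)) (ξ : PBond (F.P K) 0 → Matrix (Fin 2) (Fin 2) ℂ),
            (∀ b : PBond (F.P K) 0, (D b).IsHermitian ∧ Matrix.trace (D b) = 0) ∧ (∀ b : PBond (F.P K) 0, ‖D b‖ ≤ s₀ * ((F.L : ℝ) ^ (K - n))⁻¹) ∧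
            wilsonAction4 W' = wilsonAction4 (emb15 W (expHermField D)) ∧
            γ 0 = W ∧ ContinuousAt γ 0 ∧
            (∀ᶠ t in 𝓝 (0 : ℝ), ∃ u : GaugeTransf (F.P K) 0 (Matrix.specialUnitaryGroup (Fin 2) ℂ), GaugeField.gaugeAct u (γ t) ∈ fibre F ℰp n K hnK.le V) ∧
            (∀ b : PBond (F.P K) 0, HasDerivAt (fun t : ℝ => (γ t b : Matrix (Fin 2) (Fin 2) ℂ) * star (W b : Matrix (Fin 2) (Fin 2) ℂ)) (ξ b) 0) ∧
            (∑ b : PBond (F.P K) 0, ‖Complex.I • D b - ξ b‖ ≤ c₀ * (F.L : ℝ) ^ (K - n) * ∑ b : PBond (F.P K) 0, ‖D b‖ ^ 2) ∧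
            κ₀ * (((F.L : ℝ) ^ (K - n)) ^ 2)⁻¹ * ∑ b : PBond (F.P K) 0, ‖D b‖ ^ 2
              ≤ ∑ p : Plaq (F.P K) 0, ‖((Complex.I • D ⟨p.src, p.μ⟩) + ((W ⟨p.src, p.μ⟩ : Matrix (Fin 2) (Fin 2) ℂ) * (Complex.I • D ⟨p.src.shift p.μ, p.ν⟩) * star (W ⟨p.src, p.μ⟩ : Matrix (Fin 2) (Fin 2) ℂ))
            - (((W ⟨p.src, p.μ⟩ * W ⟨p.src.shift p.μ, p.ν⟩ * (W ⟨p.src.shift p.ν, p.μ⟩)⁻¹ : Matrix.specialUnitaryGroup (Fin 2) ℂ) : Matrix (Fin 2) (Fin 2) ℂ) * (Complex.I • D ⟨p.src.shift p.ν, p.μ⟩) * star ((W ⟨p.src, p.μ⟩ * W ⟨p.src.shift p.μ, p.ν⟩ * (W ⟨p.src.shift p.ν, p.μ⟩)⁻¹ : Matrix.specialUnitaryGroup (Fin 2) ℂ) : Matrix (Fin 2) (Fin 2) ℂ))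
            - (((GaugeField.plaqHol W p : Matrix.specialUnitaryGroup (Fin 2) ℂ) : Matrix (Fin 2) (Fin 2) ℂ) * (Complex.I • D ⟨p.src, p.ν⟩) * star ((GaugeField.plaqHol W p : Matrix.specialUnitaryGroup (Fin 2) ℂ) : Matrix (Fin 2) (Fin 2) ℂ)))‖ ^ 2) :
    ∀ (L : ℕ), 1 < L → ∀ (B₃ : ℝ), 4 < B₃ →
    ∃ e₅ a₁'' : ℝ, 0 < e₅ ∧ 0 < a₁'' ∧ ∀ (i : Idx L) (e ε₁ : ℝ) (V : GaugeField (i.1.1.P i.1.2.1) 0 (Matrix.specialUnitaryGroup (Fin 2) ℂ))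
      (U₀ W : GaugeField (i.1.1.P i.1.2.2) 0 (Matrix.specialUnitaryGroup (Fin 2) ℂ)),
      0 < ε₁ → ε₁ ≤ a₁'' → PlaqSmall ε₁ V → (L : ℝ) ^ 3 * B₃ * ε₁ ≤ e → e ≤ e₅ →
      RegPr i.1.1 i.1.2.1 i.1.2.2 ((L : ℝ) ^ 3 * B₃ * ε₁) U₀ → CloseAvg i.1.1 i.1.2.1 i.1.2.2 i.2.2.le ((L : ℝ) ^ 3 * ε₁) V U₀ →
      W ∈ regFibrePr i.1.1 i.1.2.1 i.1.2.2 i.2.2.le e V → IsCritR2 i.1.1 i.1.2.1 i.1.2.2 i.2.2.le V W →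
        IsMinOn (fun W' : GaugeField (i.1.1.P i.1.2.2) 0 (Matrix.specialUnitaryGroup (Fin 2) ℂ) => wilsonAction4 W')
          (regFibrePr i.1.1 i.1.2.1 i.1.2.2 i.2.2.le e V) W := by
  intro L hL B₃ hB₃
  obtain ⟨e₆, s₀, c₀, κ₀, he₆, hs₀, hs₀4, hc₀, hsmall, H⟩ := hrowsU L hL
  refine ⟨e₆, 1, he₆, one_pos, ?_⟩
  intro i e ε₁ V U₀ W hε₁ _hε₁a _hV hlo hhi _hRU₀ _hclose hW hWcrit
  obtain ⟨⟨F, n, K⟩, hF, hnK⟩ := i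
  have hL0 : (0 : ℝ) < (L : ℝ) := by exact_mod_cast (show 0 < L by omega)
  have he0 : 0 < e := lt_of_lt_of_le (by positivity) hlo
  have hL1 : (1 : ℝ) ≤ (F.L : ℝ) := by have := F.hL.2; exact_mod_cast (by omega : 1 ≤ F.L)
  have hℓ1 : (1 : ℝ) ≤ (F.L : ℝ) ^ (K - n) := one_le_pow₀ hL1
  have hℓ0 : (0 : ℝ) < (F.L : ℝ) ^ (K - n) := by linarith
  -- the scaled radius is `≤ s₀`, hence `4s ≤ 1`
  have hs4 : 4 * (s₀ * ((F.L : ℝ) ^ (K - n))⁻¹) ≤ 1 := by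
    have hi : ((F.L : ℝ) ^ (K - n))⁻¹ ≤ 1 := inv_le_one_of_one_le₀ hℓ1
    nlinarith [mul_le_mul_of_nonneg_left hi hs₀]
  exact isMinOn_regFibrePr_of_sliceRows_at F hnK.le V hWcrit hW (H F hF n K hnK e V W he0 hhi hW hWcrit) hs4
    (scaled_smallness F n K hhi hc₀ hsmall)

end Summit.QuantumFields.YangMills.Theorems.PV3ESigmaUniform

end
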